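import Mathlib.NumberTheory.ArithmeticFunction.Liouville
import Summits.Parity.BatemanHorn.Theorems.SoloInformedCofactorRung

/-!
# SoloInformedCofactorLiouville — the cofactor sums of the Sawin–Shusterman architecture are Liouville sums in arithmetic progressions

Soloist `solo-Parity-informed`, session 5 (claim C29).  Obstruction-side dictionary; no bearing on the
truth of `Summit.Parity.BatemanHorn`.

Context.  The one proved instance of a quadratic Bateman–Horn statement — Sawin–Shusterman over
`𝔽_q[u]` (arXiv:2008.09905, Thm 1.2; proof of Thm 8.1, p. 66) — writes `Λ = μ ∗ deg`, splits by the
degree of the divisor, and in its third range is left with Möbius sums along the quadratics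
`G_{B,g}(C) = B·C² + 2g·C + (g² + D)/B`.  Over `ℤ`, for `n² + 1`, these are exactly the cofactor
polynomials `g_{e,ν}(c) = e·c² + 2ν·c + (ν² + 1)/e` (`e ∣ ν² + 1`) of
`SoloInformedCofactorRung` (`cofactor_identity`: `(e c + ν)² + 1 = e · g_{e,ν}(c)`), and the input the
integer port would need is a power saving in `∑_{c < L} μ(g_{e,ν}(c))`, uniformly for `e ≤ x^{1-ε}`
(so `L = x/e ≥ x^ε`).

This file records, for the Liouville function `λ` (Mathlib `ArithmeticFunction.liouville`), what that
input IS in standard language: by complete multiplicativity `λ(g_{e,ν}(c)) = λ(e)·λ((ec+ν)²+1)`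
(`liouville_cofactorPoly`), hence
`∑_{c<L} λ(g_{e,ν}(c)) = λ(e) · ∑_{n < eL+ν, n ≡ ν (mod e)} λ(n²+1)`
(`sum_liouville_cofactorPoly_eq_sum_AP`) and the two sums have the same absolute value
(`abs_sum_liouville_cofactorPoly_eq`).  So uniform cancellation along the cofactor quadratics for
`e ≤ x^{1-ε}` is Liouville–Chowla for `n² + 1` in EVERY arithmetic progression `n ≡ ν (mod e)` with
`e ∣ ν² + 1`, modulus `e ≤ x^{1-ε}` and length `x/e ≥ x^ε` — progressions far shorter than their
modulus once `ε < 1/2`.  (For the linear analogue, `λ(n)` in a progression of modulus `e` and length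
`x^ε < e`, no cancellation is known or expected from GRH.)  Already the case `e = 1`
(`∑_{n<L} λ(n²+1) = o(L)`) is open.

References: W. Sawin, M. Shusterman, "Möbius cancellation on polynomial sequences and the quadratic
Bateman–Horn conjecture over function fields", arXiv:2008.09905, §1.3 and p. 66;
`Literature.Barriers.Parity.FunctionFieldMobiusBias` (no integer analogue of the Pellet–Stickelberger
identity used there).
-/

namespace Summit.Parity.BatemanHorn.Theorems

open Finset ArithmeticFunction

/-- Complete multiplicativity of Liouville's function in cofactor form: for `e ∣ m`, `m ≠ 0`,
`λ(m / e) = λ(e) · λ(m)` (since `λ(e)² = 1`). -/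
theorem liouville_div_eq {e m : ℕ} (hm : m ≠ 0) (h : e ∣ m) :
    liouville (m / e) = liouville e * liouville m := by
  obtain ⟨q, rfl⟩ := h
  have he : e ≠ 0 := by
    rintro rfl
    simp at hm
  have hq : q ≠ 0 := by
    rintro rfl
    simp at hm
  rw [Nat.mul_div_cancel_left q (Nat.pos_of_ne_zero he), liouville_apply hm, liouville_apply he,
    liouville_apply hq, cardFactors_mul he hq, pow_add, ← mul_assoc, ← pow_add,
    Even.neg_one_pow ⟨_, rfl⟩, one_mul]

/-- Liouville along the cofactor quadratic `g_{e,ν}(c) = e c² + 2ν c + (ν²+1)/e` (`e ∣ ν² + 1`):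
`λ(g_{e,ν}(c)) = λ(e) · λ((e c + ν)² + 1)`, by `cofactor_identity` and complete multiplicativity. -/
theorem liouville_cofactorPoly {e ν : ℕ} (hd : e ∣ ν ^ 2 + 1) (c : ℕ) :
    liouville (e * c ^ 2 + 2 * ν * c + (ν ^ 2 + 1) / e) =
      liouville e * liouville ((e * c + ν) ^ 2 + 1) := by
  have he : 0 < e := Nat.pos_of_ne_zero (by
    rintro rfl
    simp at hd)
  have hid := cofactor_identity hd c
  have hne : (e * c + ν) ^ 2 + 1 ≠ 0 := Nat.succ_ne_zero _
  have hdiv : e ∣ (e * c + ν) ^ 2 + 1 := ⟨_, hid⟩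
  rw [← liouville_div_eq hne hdiv, hid, Nat.mul_div_cancel_left _ he]

/-- The range-(III) sum of the Sawin–Shusterman architecture, Liouville version:
`∑_{c<L} λ(g_{e,ν}(c)) = λ(e) · ∑_{c<L} λ((e c + ν)² + 1)`. -/
theorem sum_liouville_cofactorPoly_eq {e ν : ℕ} (hd : e ∣ ν ^ 2 + 1) (L : ℕ) :
    ∑ c ∈ range L, liouville (e * c ^ 2 + 2 * ν * c + (ν ^ 2 + 1) / e) =
      liouville e * ∑ c ∈ range L, liouville ((e * c + ν) ^ 2 + 1) := by
  rw [mul_sum]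
  exact sum_congr rfl fun c _ => liouville_cofactorPoly hd c

/-- The image of `c ↦ e c + ν` (`c < L`, `ν < e`) is the arithmetic progression
`{n < eL + ν : n ≡ ν (mod e)}`. -/
theorem image_range_eq_filter_mod {e ν : ℕ} (hν : ν < e) (L : ℕ) :
    (range L).image (fun c => e * c + ν) = (range (e * L + ν)).filter (fun n => n % e = ν) := by
  have he : 0 < e := lt_of_le_of_lt (Nat.zero_le ν) hν
  ext n
  simp only [mem_image, mem_range, mem_filter]
  constructor
  · rintro ⟨c, hc, rfl⟩
    refine ⟨by nlinarith, ?_⟩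
    rw [add_comm, Nat.add_mul_mod_self_left, Nat.mod_eq_of_lt hν]
  · rintro ⟨hn, hmod⟩
    have key : e * (n / e) + ν = n := by
      have h := Nat.div_add_mod n e
      rwa [hmod] at h
    exact ⟨n / e, by nlinarith, key⟩

/-- DICTIONARY (claim C29).  For `e ∣ ν² + 1`, `ν < e`:
`∑_{c<L} λ(e c² + 2ν c + (ν²+1)/e) = λ(e) · ∑_{n < eL+ν, n % e = ν} λ(n² + 1)` — the cofactor
Möbius/Liouville sums the integer port of Sawin–Shusterman needs (uniformly for `e ≤ x^{1-ε}`,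
`L = x/e`) are Liouville sums of `n² + 1` over arithmetic progressions of modulus `e` and length `L`. -/
theorem sum_liouville_cofactorPoly_eq_sum_AP {e ν : ℕ} (hd : e ∣ ν ^ 2 + 1) (hν : ν < e) (L : ℕ) :
    ∑ c ∈ range L, liouville (e * c ^ 2 + 2 * ν * c + (ν ^ 2 + 1) / e) =
      liouville e * ∑ n ∈ (range (e * L + ν)).filter (fun n => n % e = ν), liouville (n ^ 2 + 1) := by
  have he : 0 < e := lt_of_le_of_lt (Nat.zero_le ν) hν
  rw [sum_liouville_cofactorPoly_eq hd, ← image_range_eq_filter_mod hν, sum_image]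
  rintro a _ b _ h
  exact Nat.eq_of_mul_eq_mul_left he (Nat.add_right_cancel h)

/-- Same absolute value: `|∑_{c<L} λ(g_{e,ν}(c))| = |∑_{n < eL+ν, n % e = ν} λ(n² + 1)|`.  A power
saving `≪ L^{1-η}` on the left for all `e ≤ x^{1-ε}` (the located parity input, PLAN §9) is therefore the
statement that `λ(n² + 1)` has power cancellation in every progression `n ≡ ν (mod e)`, `e ∣ ν² + 1`,
of modulus up to `x^{1-ε}` and length down to `x^ε`. -/
theorem abs_sum_liouville_cofactorPoly_eq {e ν : ℕ} (hd : e ∣ ν ^ 2 + 1) (hν : ν < e) (L : ℕ) :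
    |∑ c ∈ range L, liouville (e * c ^ 2 + 2 * ν * c + (ν ^ 2 + 1) / e)| =
      |∑ n ∈ (range (e * L + ν)).filter (fun n => n % e = ν), liouville (n ^ 2 + 1)| := by
  have he : e ≠ 0 := by
    rintro rfl
    exact Nat.not_lt_zero ν hν
  rw [sum_liouville_cofactorPoly_eq_sum_AP hd hν, abs_mul, liouville_apply he, abs_pow, abs_neg,
    abs_one, one_pow, one_mul]

end Summit.Parity.BatemanHorn.Theorems
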